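import Summits.Langlands.Langlands.Theorems.IrreducibilityBySelfDualityHeckeEigenvalueFieldStubConeGrowthCoeff
import HarnessLib

/-!
# Crux `HeckeEigenvalueField` (stmt-Langlands-13632), line `Sketch`, stub GROWTH-ω — part 2:
# moderate growth of the values of `W ⊗ E_λ` at the points `(g, c)`; matrices over `K_∞`

Helper file (part 2 of 5) for the registered stub `stub_coneForm_growth`.  Theorems only.

1. Matrices over `K_∞ = ℝ^{r₁} × ℂ^{r₂}`: the operator norm against the entries, and POSITIVITY:
   `‖x_k‖² ≤ ‖∑_i x_i x_i^*‖`, whence the entries of any square root `g` of `H = g gᴴ` (and of `g⁻¹`)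
   are controlled by the diagonal entries of `H` (and of `H⁻¹`).
2. A multilinear map on a finite-dimensional space is bounded by its values on basis tuples.
3. **Moderate growth**: every `t ∈ W ⊗ E_λ` (`W ⊆ 𝒜`) is an `E_λ`-valued function of moderate growth
   (`IsAutomorphicForm.moderateGrowth`); the height of `(g, c)` is linear in the entries of `g, g⁻¹`
   for fixed `c` (its finite part only sees `c`, `GLn.localHeight_eq_of_sndHom_eq`); hence the twisted
   evaluation `E(g) · t(g, c)` of a fixed `t`, and of a multilinear `t = T(Y₁, …, Y_r)` of matrices
   (in `∏ ‖Y_i‖`), is polynomially bounded in the size of `g` (`cfg_twistedEval_multilinear_growth`).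

[cite: BorelJacquetCorvallis1979, §1.2 and 4.2] [cite: BorelWallach2000, VII §2.2]
-/

set_option linter.dupNamespace false -- project-wide: `Summit.Langlands.Langlands` is the mandated namespace

noncomputable section

open scoped Matrix.Norms.Operator TensorProduct Classical Matrix ComplexConjugate
open Filter NumberField NumberField.mixedEmbedding
open Literature.NumberTheory.Automorphic Literature.NumberTheory.Automorphic.RealMatrixGroup
  Literature.NumberTheory.Automorphic.ConeDictionary

namespace Summit.Langlands.Langlands.Theorems.HeckeEigenvalueField.Res

/-! ### 2. Matrices over `K_∞`: entries, operator norm, hermitian squares -/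

section MatrixNorms

variable {n : ℕ} {K : Type} [Field K] [NumberField K]

/-- The operator norm is bounded by the sum of the entries. [folklore] -/
theorem cfg_norm_le_sum_entries (m : Matrix (Fin n) (Fin n) (mixedSpace K)) : ‖m‖ ≤ ∑ i, ∑ j, ‖m i j‖ := by
  rw [Matrix.linfty_opNorm_def]
  have h : (Finset.univ.sup fun i => ∑ j, ‖m i j‖₊) ≤ ∑ i, ∑ j, ‖m i j‖₊ :=
    Finset.sup_le fun i _ =>
      Finset.single_le_sum (f := fun i => ∑ j, ‖m i j‖₊) (fun _ _ => bot_le) (Finset.mem_univ i)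
  calc (((Finset.univ.sup fun i => ∑ j, ‖m i j‖₊ : NNReal) : ℝ)) ≤ ((∑ i, ∑ j, ‖m i j‖₊ : NNReal) : ℝ) :=
        NNReal.coe_le_coe.2 h
    _ = ∑ i, ∑ j, ‖m i j‖ := by simp only [NNReal.coe_sum, coe_nnnorm]

/-- The operator norm of the conjugate transpose is bounded by the sum of the entries. [folklore] -/
theorem cfg_norm_conjTranspose_le_sum_entries (m : Matrix (Fin n) (Fin n) (mixedSpace K)) :
    ‖mᴴ‖ ≤ ∑ i, ∑ j, ‖m i j‖ := by
  refine (cfg_norm_le_sum_entries mᴴ).trans_eq ?_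
  rw [Finset.sum_comm]
  simp only [Matrix.conjTranspose_apply, norm_star]

/-- **Positivity in `K_∞ = ℝ^{r₁} × ℂ^{r₂}`**: `‖x_k‖² ≤ ‖∑_i x_i x_i^*‖` (every component of the sum
is a sum of squares of absolute values). [folklore] -/
theorem cfg_norm_sq_le_norm_sum_mul_star (f : Fin n → mixedSpace K) (k : Fin n) :
    ‖f k‖ ^ 2 ≤ ‖∑ i, f i * star (f i)‖ := by
  set s := ∑ i, f i * star (f i) with hs
  have h1 : ∀ w, ‖(f k).1 w‖ ^ 2 ≤ ‖s‖ := by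
    intro w
    have e : s.1 w = ∑ i, (f i).1 w * (f i).1 w := by
      simp [hs, Prod.fst_sum, Finset.sum_apply]
    have hle : (f k).1 w * (f k).1 w ≤ s.1 w := by
      rw [e]
      exact Finset.single_le_sum (f := fun i => (f i).1 w * (f i).1 w) (fun i _ => mul_self_nonneg _)
        (Finset.mem_univ k)
    calc ‖(f k).1 w‖ ^ 2 = (f k).1 w * (f k).1 w := by rw [Real.norm_eq_abs, sq_abs, sq]
      _ ≤ s.1 w := hle
      _ ≤ ‖s.1 w‖ := Real.le_norm_self _
      _ ≤ ‖s.1‖ := norm_le_pi_norm _ w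
      _ ≤ ‖s‖ := by rw [Prod.norm_def]; exact le_max_left _ _
  have h2 : ∀ w, ‖(f k).2 w‖ ^ 2 ≤ ‖s‖ := by
    intro w
    have e : s.2 w = ((∑ i, Complex.normSq ((f i).2 w) : ℝ) : ℂ) := by
      rw [Complex.ofReal_sum]
      simp [hs, Prod.snd_sum, Finset.sum_apply, Complex.mul_conj]
    have hnn : 0 ≤ ∑ i, Complex.normSq ((f i).2 w) := Finset.sum_nonneg fun i _ => Complex.normSq_nonneg _
    calc ‖(f k).2 w‖ ^ 2 = Complex.normSq ((f k).2 w) := (Complex.normSq_eq_norm_sq _).symm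
      _ ≤ ∑ i, Complex.normSq ((f i).2 w) :=
          Finset.single_le_sum (f := fun i => Complex.normSq ((f i).2 w)) (fun i _ => Complex.normSq_nonneg _)
            (Finset.mem_univ k)
      _ = ‖s.2 w‖ := by rw [e, Complex.norm_real, Real.norm_eq_abs, abs_of_nonneg hnn]
      _ ≤ ‖s.2‖ := norm_le_pi_norm _ w
      _ ≤ ‖s‖ := by rw [Prod.norm_def]; exact le_max_right _ _
  have key : ‖f k‖ ≤ Real.sqrt ‖s‖ := by
    rw [Prod.norm_def, max_le_iff, pi_norm_le_iff_of_nonneg (Real.sqrt_nonneg _),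
      pi_norm_le_iff_of_nonneg (Real.sqrt_nonneg _)]
    refine ⟨fun w => ?_, fun w => ?_⟩
    · have := Real.abs_le_sqrt (h1 w)
      rwa [abs_norm] at this
    · have := Real.abs_le_sqrt (h2 w)
      rwa [abs_norm] at this
  calc ‖f k‖ ^ 2 ≤ (Real.sqrt ‖s‖) ^ 2 := pow_le_pow_left₀ (norm_nonneg _) key 2
    _ = ‖s‖ := Real.sq_sqrt (norm_nonneg _)

/-- **Entries of a square root are controlled by the square**: if `g gᴴ = H` then
`‖g_ik‖² ≤ ‖H_ii‖`. [folklore] -/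
theorem cfg_norm_entry_sq_le_of_mul_conjTranspose (g H : Matrix (Fin n) (Fin n) (mixedSpace K))
    (hg : g * gᴴ = H) (i k : Fin n) : ‖g i k‖ ^ 2 ≤ ‖H i i‖ := by
  have e : H i i = ∑ k, g i k * star (g i k) := by
    rw [← hg, Matrix.mul_apply]
    rfl
  rw [e]
  exact cfg_norm_sq_le_norm_sum_mul_star (fun k => g i k) k

/-- The same for `gᴴ g = H`: `‖g_kj‖² ≤ ‖H_jj‖`. [folklore] -/
theorem cfg_norm_entry_sq_le_of_conjTranspose_mul (g H : Matrix (Fin n) (Fin n) (mixedSpace K))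
    (hg : gᴴ * g = H) (k j : Fin n) : ‖g k j‖ ^ 2 ≤ ‖H j j‖ := by
  have e : H j j = ∑ k, g k j * star (g k j) := by
    rw [← hg, Matrix.mul_apply]
    refine Finset.sum_congr rfl fun k _ => ?_
    rw [Matrix.conjTranspose_apply, mul_comm]
  rw [e]
  exact cfg_norm_sq_le_norm_sum_mul_star (fun k => g k j) k

end MatrixNorms

/-! ### 4. Moderate growth of the values of `W ⊗ E_λ` at the adelic points `(g, c)` -/

section Multilinear

/-- Coordinates in a basis of a finite-dimensional normed space are bounded linear functionals.
[folklore] -/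
theorem cfg_exists_coord_bound {D : Type*} [NormedAddCommGroup D] [NormedSpace ℝ D] [FiniteDimensional ℝ D]
    {ι : Type*} [Fintype ι] (b : Module.Basis ι ℝ D) :
    ∃ Cb : ℝ, 0 ≤ Cb ∧ ∀ (j : ι) (y : D), ‖b.coord j y‖ ≤ Cb * ‖y‖ := by
  refine ⟨∑ j, ‖LinearMap.toContinuousLinearMap (b.coord j)‖, Finset.sum_nonneg fun j _ => norm_nonneg _,
    fun j y => ((LinearMap.toContinuousLinearMap (b.coord j)).le_opNorm y).trans ?_⟩
  exact mul_le_mul_of_nonneg_right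
    (Finset.single_le_sum (f := fun j => ‖LinearMap.toContinuousLinearMap (b.coord j)‖)
      (fun _ _ => norm_nonneg _) (Finset.mem_univ j)) (norm_nonneg _)

/-- **A multilinear map is bounded by its values on basis tuples**: if `‖F(b_J)‖ ≤ B` for all tuples
`b_J` of basis vectors then `‖F(Y)‖ ≤ (#J · C_b^r · B) ∏ ‖Y_i‖` (expand each `Y_i` in the basis).
[folklore] -/
theorem cfg_multilinear_bound {D : Type*} [NormedAddCommGroup D] [NormedSpace ℝ D] {ι : Type*} [Fintype ι]
    (b : Module.Basis ι ℝ D) {Cb : ℝ} (hCb0 : 0 ≤ Cb) (hCb : ∀ (j : ι) (y : D), ‖b.coord j y‖ ≤ Cb * ‖y‖)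
    {F' : Type*} [SeminormedAddCommGroup F'] [NormedSpace ℝ F'] {r : ℕ}
    (F : MultilinearMap ℝ (fun _ : Fin r => D) F') {B : ℝ} (hB0 : 0 ≤ B)
    (hB : ∀ J : Fin r → ι, ‖F (fun i => b (J i))‖ ≤ B) (Y : Fin r → D) :
    ‖F Y‖ ≤ (Fintype.card (Fin r → ι) * Cb ^ r * B) * ∏ i, ‖Y i‖ := by
  have hY : Y = fun i => ∑ j, b.coord j (Y i) • b j := funext fun i => (b.sum_repr (Y i)).symm
  have hexp : F Y = ∑ J : Fin r → ι, (∏ i, b.coord (J i) (Y i)) • F (fun i => b (J i)) := by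
    conv_lhs => rw [hY]
    rw [MultilinearMap.map_sum F (fun i j => b.coord j (Y i) • b j)]
    refine Finset.sum_congr rfl fun J _ => ?_
    rw [MultilinearMap.map_smul_univ]
  have hcoef : ∀ J : Fin r → ι, ‖∏ i, b.coord (J i) (Y i)‖ ≤ Cb ^ r * ∏ i, ‖Y i‖ := by
    intro J
    calc ‖∏ i, b.coord (J i) (Y i)‖ ≤ ∏ i, ‖b.coord (J i) (Y i)‖ := Finset.norm_prod_le _ _
      _ ≤ ∏ i, (Cb * ‖Y i‖) := Finset.prod_le_prod (fun i _ => norm_nonneg _) fun i _ => hCb _ _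
      _ = Cb ^ r * ∏ i, ‖Y i‖ := by
          rw [Finset.prod_mul_distrib, Finset.prod_const, Finset.card_univ, Fintype.card_fin]
  rw [hexp]
  refine (norm_sum_le _ _).trans ?_
  calc ∑ J, ‖(∏ i, b.coord (J i) (Y i)) • F (fun i => b (J i))‖
      ≤ ∑ J : Fin r → ι, (Cb ^ r * ∏ i, ‖Y i‖) * B := Finset.sum_le_sum fun J _ => by
          rw [_root_.norm_smul]
          exact mul_le_mul (hcoef J) (hB J) (norm_nonneg _)
            (mul_nonneg (pow_nonneg hCb0 _) (Finset.prod_nonneg fun i _ => norm_nonneg _))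
    _ = (Fintype.card (Fin r → ι) * Cb ^ r * B) * ∏ i, ‖Y i‖ := by
          rw [Finset.sum_const, Finset.card_univ, nsmul_eq_mul]
          have := hB0
          ring

end Multilinear

section EvalGrowth

variable {n : ℕ} {K : Type} [Field K] [NumberField K] {hcpt : isCompact_glFiniteIntegralLevel n K}
  (π : AutomorphicRepData (AutomorphyDatum.gl n K hcpt))
  (S : Finset {w : InfinitePlace K // w.IsReal}) (lam : (K →+* ℂ) → Fin n → ℤ)
  (sz : (AutomorphyDatum.gl n K hcpt).arch.carrier → ℝ)

/-- **Moderate growth of the values of `W ⊗ E_λ`**: every `t ∈ W ⊗ E_λ` evaluates to an `E_λ`-valued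
function with `‖t(x)‖ ≤ C (1 ⊔ ‖x‖)^r` (the elements of `W ⊆ 𝒜` are automorphic forms, hence of
moderate growth). [cite: BorelJacquetCorvallis1979, §1.2 and 4.2] -/
theorem cfg_evalTensor_growth (t : π.W ⊗[ℂ] ResGLnCohomology.CoeffModule ℂ n K lam) :
    ∃ (C : ℝ) (r : ℕ), 0 ≤ C ∧ ∀ x, ‖π.evalTensor (ResGLnCohomology.CoeffModule ℂ n K lam) t x‖ ≤
      C * (1 ⊔ adelicHeightGL n K x) ^ r := by
  have h1 : ∀ x : (AdelicGroupData.gl n K).Adelic, (1 : ℝ) ≤ 1 ⊔ adelicHeightGL n K x := fun x => le_sup_left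
  induction t using TensorProduct.induction_on with
  | zero => exact ⟨0, 0, le_rfl, fun x => by rw [map_zero, Pi.zero_apply, norm_zero, zero_mul]⟩
  | tmul ψ e =>
    obtain ⟨C, r, hC⟩ := (isAutomorphicForm_of_mem_automorphicForms_gl
      (π.stable.le_automorphicForms ψ.2)).moderateGrowth
    refine ⟨max C 0 * ‖e‖, r, mul_nonneg (le_max_right _ _) (norm_nonneg _), fun x => ?_⟩
    rw [AutomorphicRepData.evalTensor_tmul, _root_.norm_smul]
    have hx : ‖(ψ : (AdelicGroupData.gl n K).Adelic → ℂ) x‖ ≤ max C 0 * (1 ⊔ adelicHeightGL n K x) ^ r :=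
      (hC x).trans (mul_le_mul_of_nonneg_right (le_max_left _ _) (pow_nonneg (zero_le_one.trans (h1 x)) _))
    calc ‖(ψ : (AdelicGroupData.gl n K).Adelic → ℂ) x‖ * ‖e‖
        ≤ max C 0 * (1 ⊔ adelicHeightGL n K x) ^ r * ‖e‖ := mul_le_mul_of_nonneg_right hx (norm_nonneg _)
      _ = max C 0 * ‖e‖ * (1 ⊔ adelicHeightGL n K x) ^ r := by ring
  | add t t' ht ht' =>
    exact cfg_mono _ (cfg_add (fun x => 1 ⊔ adelicHeightGL n K x) h1 ht ht') fun x => by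
      rw [map_add, Pi.add_apply]; exact norm_add_le _ _

/-- **The height of `(g, c)` is linear in the entries of `g, g⁻¹` for fixed `c`**: the finite part
`∏_v H_v` of `‖(g, c)‖ = H_∞ ∏_v H_v` only depends on `c`, and `H_∞(g, c) = max (|g_ij|, |g⁻¹_ij|)`.
[cite: BorelJacquetCorvallis1979, §1.2] -/
theorem cfg_height_adelicPt_le (hsz : ∀ g, 1 ≤ sz g)
    (hE : ∀ (g : (AutomorphyDatum.gl n K hcpt).arch.carrier) i j,
      ‖((g : GL (Fin n) (mixedSpace K)) : Matrix (Fin n) (Fin n) (mixedSpace K)) i j‖ ≤ sz g)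
    (hI : ∀ (g : (AutomorphyDatum.gl n K hcpt).arch.carrier) i j, ‖(((g⁻¹ : (AutomorphyDatum.gl n K hcpt).arch.carrier) : GL (Fin n) (mixedSpace K)) :
      Matrix (Fin n) (Fin n) (mixedSpace K)) i j‖ ≤ sz g)
    (c : BigHeckeGLn.FiniteAdelicGL n K) :
    ∃ B : ℝ, 1 ≤ B ∧ ∀ g, 1 ⊔ adelicHeightGL n K (adelicPt hcpt g c) ≤ B * sz g := by
  set F : ℝ := ∏ᶠ v, (GLn.localHeight n K v (GLn.ofFinite n K c) : ℝ) with hF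
  have hF0 : 0 ≤ F := finprod_nonneg fun v => NNReal.coe_nonneg _
  refine ⟨1 + F, le_add_of_nonneg_right hF0, fun g => ?_⟩
  have hx : adelicPt hcpt g c =
      (GLn.ofInfinite n K (g : GL (Fin n) (mixedSpace K)) * GLn.ofFinite n K c : GL (Fin n) (AdeleRing (𝓞 K) K)) :=
    rfl
  have htm : GLn.toMixed n K (adelicPt hcpt g c) = (g : GL (Fin n) (mixedSpace K)) := by
    rw [hx, map_mul, GLn.toMixed_ofInfinite, GLn.toMixed_ofFinite, mul_one]
  have hsnd : GLn.sndHom n K (adelicPt hcpt g c) = GLn.sndHom n K (GLn.ofFinite n K c) := by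
    rw [hx, map_mul, GLn.sndHom_ofInfinite, one_mul]
  have hfin : ∏ᶠ v, (GLn.localHeight n K v (adelicPt hcpt g c) : ℝ) = F :=
    finprod_congr fun v => by rw [GLn.localHeight_eq_of_sndHom_eq hsnd v]
  have h0 : 0 ≤ sz g := zero_le_one.trans (hsz g)
  have harch : (GLn.archHeight n K (adelicPt hcpt g c) : ℝ) ≤ sz g := by
    rw [← Real.coe_toNNReal (sz g) h0, NNReal.coe_le_coe]
    unfold GLn.archHeight
    rw [htm]
    refine Finset.sup_le fun ij _ => sup_le ?_ ?_
    · rw [← NNReal.coe_le_coe, Real.coe_toNNReal _ h0, coe_nnnorm]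
      exact hE g ij.1 ij.2
    · rw [← NNReal.coe_le_coe, Real.coe_toNNReal _ h0, coe_nnnorm, ← Subgroup.coe_inv]
      exact hI g ij.1 ij.2
  have hheight : adelicHeightGL n K (adelicPt hcpt g c) ≤ sz g * F := by
    unfold adelicHeightGL
    rw [hfin]
    exact mul_le_mul_of_nonneg_right harch hF0
  have h1 := hsz g
  refine sup_le ?_ (hheight.trans ?_)
  · nlinarith
  · nlinarith

/-- The values of `t ∈ W ⊗ E_λ` at the points `(g, c)` are polynomially bounded in the size of `g`.
[cite: BorelJacquetCorvallis1979, §1.2] -/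
theorem cfg_evalTensor_adelicPt_growth (hsz : ∀ g, 1 ≤ sz g)
    (hE : ∀ (g : (AutomorphyDatum.gl n K hcpt).arch.carrier) i j,
      ‖((g : GL (Fin n) (mixedSpace K)) : Matrix (Fin n) (Fin n) (mixedSpace K)) i j‖ ≤ sz g)
    (hI : ∀ (g : (AutomorphyDatum.gl n K hcpt).arch.carrier) i j, ‖(((g⁻¹ : (AutomorphyDatum.gl n K hcpt).arch.carrier) : GL (Fin n) (mixedSpace K)) :
      Matrix (Fin n) (Fin n) (mixedSpace K)) i j‖ ≤ sz g)
    (c : BigHeckeGLn.FiniteAdelicGL n K) (t : π.W ⊗[ℂ] ResGLnCohomology.CoeffModule ℂ n K lam) :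
    ∃ (C : ℝ) (k : ℕ), 0 ≤ C ∧ ∀ g,
      ‖π.evalTensor (ResGLnCohomology.CoeffModule ℂ n K lam) t (adelicPt hcpt g c)‖ ≤ C * sz g ^ k := by
  obtain ⟨C, r, hC, h⟩ := cfg_evalTensor_growth π lam t
  obtain ⟨B, hB, hBg⟩ := cfg_height_adelicPt_le sz hsz hE hI c
  refine ⟨C * B ^ r, r, mul_nonneg hC (pow_nonneg (zero_le_one.trans hB) _), fun g => (h _).trans ?_⟩
  rw [mul_assoc, ← mul_pow]
  exact mul_le_mul_of_nonneg_left (pow_le_pow_left₀ (zero_le_one.trans le_sup_left) (hBg g) r) hC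

/-- **The twisted evaluation `E(g) · t(g, c)` of a fixed `t ∈ W ⊗ E_λ` is polynomially bounded in
the size of `g`** (moderate growth of the automorphic forms, polynomial growth of the algebraic
coefficient representation). [cite: BorelWallach2000, VII §2.2] [cite: BorelJacquetCorvallis1979, §1.2] -/
theorem cfg_twistedEval_growth (hsz : ∀ g, 1 ≤ sz g)
    (hE : ∀ (g : (AutomorphyDatum.gl n K hcpt).arch.carrier) i j,
      ‖((g : GL (Fin n) (mixedSpace K)) : Matrix (Fin n) (Fin n) (mixedSpace K)) i j‖ ≤ sz g)
    (hI : ∀ (g : (AutomorphyDatum.gl n K hcpt).arch.carrier) i j, ‖(((g⁻¹ : (AutomorphyDatum.gl n K hcpt).arch.carrier) : GL (Fin n) (mixedSpace K)) :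
      Matrix (Fin n) (Fin n) (mixedSpace K)) i j‖ ≤ sz g)
    (c : BigHeckeGLn.FiniteAdelicGL n K) (t : Carrier π lam) :
    ∃ (C : ℝ) (k : ℕ), 0 ≤ C ∧ ∀ g, ‖twistedEval π S lam g c t‖ ≤ C * sz g ^ k := by
  obtain ⟨C₁, k₁, hC₁, h₁⟩ := cfg_archCoeffRepSign_growth sz hsz hE hI S lam
  have h₂ := cfg_evalTensor_adelicPt_growth π lam sz hsz hE hI c
    (@id (π.W ⊗[ℂ] ResGLnCohomology.CoeffModule ℂ n K lam) t)
  refine cfg_mono sz (cfg_mul sz (fun g => mul_nonneg hC₁ (pow_nonneg (zero_le_one.trans (hsz g)) _))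
    (fun _ => norm_nonneg _) ⟨C₁, k₁, hC₁, fun g => le_rfl⟩ h₂) fun g => ?_
  rw [twistedEval_apply]
  exact h₁ g _

/-- **Twisted evaluation of a multilinear `W ⊗ E_λ`-valued map of matrices**: for `T` multilinear,
`‖E(g) (T Y)(g, c)‖ ≤ C sz(g)^k ∏ ‖Y_i‖` (expand `Y` in a basis of `M_n(K_∞)`: finitely many fixed
tensors `T(b_J)`, each of polynomial growth). [cite: BorelWallach2000, VII §2.2] -/
theorem cfg_twistedEval_multilinear_growth (hsz : ∀ g, 1 ≤ sz g)
    (hE : ∀ (g : (AutomorphyDatum.gl n K hcpt).arch.carrier) i j,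
      ‖((g : GL (Fin n) (mixedSpace K)) : Matrix (Fin n) (Fin n) (mixedSpace K)) i j‖ ≤ sz g)
    (hI : ∀ (g : (AutomorphyDatum.gl n K hcpt).arch.carrier) i j, ‖(((g⁻¹ : (AutomorphyDatum.gl n K hcpt).arch.carrier) : GL (Fin n) (mixedSpace K)) :
      Matrix (Fin n) (Fin n) (mixedSpace K)) i j‖ ≤ sz g)
    (c : BigHeckeGLn.FiniteAdelicGL n K) {r : ℕ}
    (T : MultilinearMap ℝ (fun _ : Fin r => Matrix (Fin n) (Fin n) (mixedSpace K)) (Carrier π lam)) :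
    ∃ (C : ℝ) (k : ℕ), 0 ≤ C ∧ ∀ (g : (AutomorphyDatum.gl n K hcpt).arch.carrier)
      (Y : Fin r → Matrix (Fin n) (Fin n) (mixedSpace K)),
      ‖twistedEval π S lam g c (T Y)‖ ≤ C * sz g ^ k * ∏ i, ‖Y i‖ := by
  let b := Module.finBasis ℝ (Matrix (Fin n) (Fin n) (mixedSpace K))
  obtain ⟨Cb, hCb0, hCb⟩ := cfg_exists_coord_bound b
  have hJ : ∀ J : Fin r → Fin (Module.finrank ℝ (Matrix (Fin n) (Fin n) (mixedSpace K))),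
      ∃ (C : ℝ) (k : ℕ), 0 ≤ C ∧ ∀ g, ‖twistedEval π S lam g c (T fun i => b (J i))‖ ≤ C * sz g ^ k :=
    fun J => cfg_twistedEval_growth π S lam sz hsz hE hI c (T fun i => b (J i))
  obtain ⟨C, k, hC, hCk⟩ := cfg_sum sz hsz
    (Finset.univ : Finset (Fin r → Fin (Module.finrank ℝ (Matrix (Fin n) (Fin n) (mixedSpace K)))))
    (f := fun (J : Fin r → Fin (Module.finrank ℝ (Matrix (Fin n) (Fin n) (mixedSpace K)))) g =>
      ‖twistedEval π S lam g c (T fun i => b (J i))‖)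
    fun J _ => hJ J
  have hK0 : (0 : ℝ) ≤ (Fintype.card (Fin r → Fin (Module.finrank ℝ (Matrix (Fin n) (Fin n) (mixedSpace K)))) : ℝ) :=
    Nat.cast_nonneg _
  refine ⟨(Fintype.card (Fin r → Fin (Module.finrank ℝ (Matrix (Fin n) (Fin n) (mixedSpace K))))) * Cb ^ r * C,
    k, mul_nonneg (mul_nonneg hK0 (pow_nonneg hCb0 _)) hC, fun g Y => ?_⟩
  have hszk : 0 ≤ C * sz g ^ k := mul_nonneg hC (pow_nonneg (zero_le_one.trans (hsz g)) _)
  have hBJ : ∀ J : Fin r → Fin (Module.finrank ℝ (Matrix (Fin n) (Fin n) (mixedSpace K))),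
      ‖twistedEval π S lam g c (T fun i => b (J i))‖ ≤ C * sz g ^ k := fun J =>
    (Finset.single_le_sum
      (f := fun J : Fin r → Fin (Module.finrank ℝ (Matrix (Fin n) (Fin n) (mixedSpace K))) =>
        ‖twistedEval π S lam g c (T fun i => b (J i))‖)
      (fun _ _ => norm_nonneg _) (Finset.mem_univ J)).trans (hCk g)
  have h := cfg_multilinear_bound b hCb0 hCb ((twistedEval π S lam g c).compMultilinearMap T) hszk
    (fun J => by rw [LinearMap.compMultilinearMap_apply]; exact hBJ J) Y
  rw [LinearMap.compMultilinearMap_apply] at h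
  calc _ ≤ _ := h
    _ = _ := by ring

end EvalGrowth

/-- **Registered sub-goal (part 2 of stub `stub_coneForm_growth`): the twisted evaluation
`E(g) · (T Y)(g, c)` of a multilinear `W ⊗ E_λ`-valued map of matrices is polynomially bounded** in
any size `sz ≥ 1` dominating the entries of `g, g⁻¹`, and in `∏ ‖Y_i‖`.
[cite: BorelWallach2000, VII §2.2] [cite: BorelJacquetCorvallis1979, §1.2] -/
theorem stub_coneGrowth_twistedEval {n : ℕ} {K : Type} [Field K] [NumberField K]
    {hcpt : isCompact_glFiniteIntegralLevel n K} (π : AutomorphicRepData (AutomorphyDatum.gl n K hcpt))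
    (S : Finset {w : InfinitePlace K // w.IsReal}) (lam : (K →+* ℂ) → Fin n → ℤ)
    (sz : (AutomorphyDatum.gl n K hcpt).arch.carrier → ℝ) (hsz : ∀ g, 1 ≤ sz g)
    (hE : ∀ (g : (AutomorphyDatum.gl n K hcpt).arch.carrier) i j,
      ‖((g : GL (Fin n) (mixedSpace K)) : Matrix (Fin n) (Fin n) (mixedSpace K)) i j‖ ≤ sz g)
    (hI : ∀ (g : (AutomorphyDatum.gl n K hcpt).arch.carrier) i j, ‖(((g⁻¹ : (AutomorphyDatum.gl n K hcpt).arch.carrier) : GL (Fin n) (mixedSpace K)) :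
      Matrix (Fin n) (Fin n) (mixedSpace K)) i j‖ ≤ sz g)
    (c : BigHeckeGLn.FiniteAdelicGL n K) {r : ℕ}
    (T : MultilinearMap ℝ (fun _ : Fin r => Matrix (Fin n) (Fin n) (mixedSpace K)) (ConeDictionary.Carrier π lam)) :
    ∃ (C : ℝ) (k : ℕ), 0 ≤ C ∧ ∀ (g : (AutomorphyDatum.gl n K hcpt).arch.carrier)
      (Y : Fin r → Matrix (Fin n) (Fin n) (mixedSpace K)),
      ‖ConeDictionary.twistedEval π S lam g c (T Y)‖ ≤ C * sz g ^ k * ∏ i, ‖Y i‖ :=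
  cfg_twistedEval_multilinear_growth π S lam sz hsz hE hI c T

end Summit.Langlands.Langlands.Theorems.HeckeEigenvalueField.Res

end
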